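import Summits.Ventures.LatticeQCDFlow.Exactness.FlowSamplerSquareIntegrable
import Summits.Ventures.LatticeQCDFlow.Exactness.Phi4FlowSignMagnetisation
import HarnessLib

/-!
# The exact flow sampler is a SELF-ADJOINT CONTRACTION of all of `L²(e^{−S})`, and `L²` is stable under it

HONEST FRAMING: exact (Metropolis-corrected) sampling algorithms for lattice gauge theory;
figures of merit are autocorrelation/cost numbers at stated couplings and volumes; no
continuum-physics claim.  (SCALAR calibration rung S0-A: not a gauge result.)

Venture `LatticeQCDFlow` (cell pub-lqcd), topic `Exactness`; FANOUT row 2 (`s0-phi4`, FLOW arm: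
independence Metropolis `K = imhOp μ w q̃`).  NEW WORK of the cell over
`Exactness/FlowSamplerSquareIntegrable.lean` (the operator on `L¹(w)`: jump domination, exactness,
product integrability of the symmetrised flow against square-integrable observables) and the
quadratic-form step `sq_add_mul_le` of `FlowSamplerOperator` and the weighted Cauchy–Schwarz
`sq_integral_le_integral_mul` of `Phi4FlowSignMagnetisation`.  Nothing is cited as a fact.  Printed
counterpart NAMED ONLY: Tierney 1994 (a `π`-invariant Markov kernel is a contraction of `L²(π)`;
Metropolis–Hastings kernels are self-adjoint there).

## What is proved (general `(X, μ)` s-finite; `w > 0` integrable, `q > 0` measurable integrable with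
`∫ q = 1`; "square-integrable" = measurable with `∫ f² w < ∞`)

* **`integral_imhOp_mul_mul_weight_comm`** — DETAILED BALANCE ON `L²(w)`: `∫ (K f) h w = ∫ f (K h) w`
  for all square-integrable `f, h` ((symm) of the `RevOp` format; swap of the product integral of
  `s(t,t') f(t') h(t)`, dominated by `h² w ⊗ q + q ⊗ f² w`);
* `imhOp_eq_jump_add_hold_of_mul_weight` — `K g = ∫ α q g + (1 − ∫ α q) g` on `L¹(w)`;
* **`imhOp_sq_le_imhOp_sq_of_sq`** — pointwise Jensen `(K f)² ≤ K(f²)` for square-integrable `f`;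
* **`imhOp_sq_integrable`** — (stab) + (contr): `K f` is again measurable square-integrable and
  `∫ (K f)² w ≤ ∫ f² w` (Jensen, then exactness at `f²`, which is in `L¹(w)`).

With `FlowSamplerSquareIntegrable` this supplies (int), (comb), (stab), (lin), (symm), (contr) of the
tree's `RevOp` format for the class of square-integrable observables; (pos) is
`FlowSamplerSquareIntegrablePositive.lean`.
NOT CLAIMED: anything for non-square-integrable observables; any number for a trained network.
-/

namespace Summit.Ventures.LatticeQCDFlow.Exactness

open Real MeasureTheory Filter Finset Set

section General

variable {X : Type*} [MeasurableSpace X] {μ : Measure X} {w q : X → ℝ}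

/-! ## §1 Jump + hold, pointwise Jensen, contraction and stability on `L²(w)`
(weighted Cauchy–Schwarz under integrability hypotheses only is the tree's
`Phi4FlowSignMagnetisation.sq_integral_le_integral_mul`) -/

/-- **Jump + hold decomposition on `L¹(w)`**:
`(K g)(t) = ∫ α(t,t') q(t') g(t') dt' + (1 − ∫ α(t,t') q(t') dt') g(t)`. -/
theorem imhOp_eq_jump_add_hold_of_mul_weight (hw0 : ∀ t, 0 < w t) (hwm : Measurable w)
    (hq0 : ∀ t, 0 < q t) (hqm : Measurable q) (hqi : Integrable q μ) (hq1 : ∫ t, q t ∂μ = 1)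
    {g : X → ℝ} (hgm : Measurable g) (hgw : Integrable (fun t => g t * w t) μ) (t : X) :
    imhOp μ w q g t
      = (∫ t', imhAcceptQ w q t t' * q t' * g t' ∂μ)
        + (1 - ∫ t', imhAcceptQ w q t t' * q t' ∂μ) * g t := by
  unfold imhOp
  have h1 := integrable_imh_jump hw0 hwm hq0 hqm hgm hgw t
  have h2 := integrable_one_sub_imhAcceptQ_mul (μ := μ) hw0 hwm hq0 hqm hqi t
  have e : ∀ t', (imhAcceptQ w q t t' * g t' + (1 - imhAcceptQ w q t t') * g t) * q t'
      = imhAcceptQ w q t t' * q t' * g t' + g t * ((1 - imhAcceptQ w q t t') * q t') := fun t' => by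
    ring
  simp_rw [e]
  rw [integral_add h1 (h2.const_mul (g t)), integral_const_mul]
  have hrej : ∫ t', (1 - imhAcceptQ w q t t') * q t' ∂μ
      = 1 - ∫ t', imhAcceptQ w q t t' * q t' ∂μ := by
    have e' : ∀ t', (1 - imhAcceptQ w q t t') * q t' = q t' - imhAcceptQ w q t t' * q t' :=
      fun t' => by ring
    simp_rw [e']
    rw [integral_sub hqi (integrable_imhAcceptQ_mul hw0 hwm hq0 hqm hqi t), hq1]
  rw [hrej]
  ring

/-- **Pointwise Jensen on `L²(w)`: `(K f)(t)² ≤ K(f²)(t)`** for measurable square-integrable `f`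
(the one-step law from `t` is a probability measure; `f² ∈ L¹(w)` so `K(f²)` is defined). -/
theorem imhOp_sq_le_imhOp_sq_of_sq (hw0 : ∀ t, 0 < w t) (hwm : Measurable w)
    (hwi : Integrable w μ) (hq0 : ∀ t, 0 < q t) (hqm : Measurable q) (hqi : Integrable q μ)
    (hq1 : ∫ t, q t ∂μ = 1) {f : X → ℝ} (hfm : Measurable f)
    (hf2 : Integrable (fun t => f t ^ 2 * w t) μ) (t : X) :
    imhOp μ w q f t ^ 2 ≤ imhOp μ w q (fun s => f s ^ 2) t := by
  have hw0' : ∀ t, 0 ≤ w t := fun t => (hw0 t).le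
  have hfw := integrable_mul_weight_of_sq hw0' hwm hwi hfm hf2
  have ha0 : ∀ t', 0 ≤ imhAcceptQ w q t t' := fun t' => imhAcceptQ_nonneg hw0 hq0 t t'
  have ha1 : ∀ t', imhAcceptQ w q t t' ≤ 1 := fun t' => imhAcceptQ_le_one w q t t'
  set m : X → ℝ := fun t' => imhAcceptQ w q t t' * q t' with hm
  have hm0 : ∀ t', 0 ≤ m t' := fun t' => mul_nonneg (ha0 t') (hq0 t').le
  have hmi : Integrable m μ := integrable_imhAcceptQ_mul hw0 hwm hq0 hqm hqi t
  have hmg : Integrable (fun t' => m t' * f t') μ := integrable_imh_jump hw0 hwm hq0 hqm hfm hfw t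
  have hmg2 : Integrable (fun t' => m t' * f t' ^ 2) μ :=
    integrable_imh_jump hw0 hwm hq0 hqm (hfm.pow_const 2) hf2 t
  -- the holding mass is nonnegative: `∫ α q ≤ ∫ q = 1`
  have hU1 : ∫ t', m t' ∂μ ≤ 1 := by
    rw [← hq1]
    exact integral_mono hmi hqi fun t' => by
      calc m t' = imhAcceptQ w q t t' * q t' := rfl
        _ ≤ 1 * q t' := mul_le_mul_of_nonneg_right (ha1 t') (hq0 t').le
        _ = q t' := one_mul _
  have hU0 : 0 ≤ ∫ t', m t' ∂μ := integral_nonneg hm0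
  have hCS := sq_integral_le_integral_mul (μ := μ) hm0 hmi hmg hmg2
  have hv0 : 0 ≤ ∫ t', m t' * f t' ^ 2 ∂μ :=
    integral_nonneg fun t' => mul_nonneg (hm0 t') (sq_nonneg _)
  have key := sq_add_mul_le (x := f t) hU0 (sub_nonneg.2 hU1) hv0 hCS
  rw [imhOp_eq_jump_add_hold_of_mul_weight hw0 hwm hq0 hqm hqi hq1 hfm hfw t,
    imhOp_eq_jump_add_hold_of_mul_weight hw0 hwm hq0 hqm hqi hq1 (hfm.pow_const 2) hf2 t]
  calc ((∫ t', imhAcceptQ w q t t' * q t' * f t' ∂μ)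
        + (1 - ∫ t', imhAcceptQ w q t t' * q t' ∂μ) * f t) ^ 2
      ≤ ((∫ t', m t' ∂μ) + (1 - ∫ t', m t' ∂μ))
          * ((∫ t', m t' * f t' ^ 2 ∂μ) + (1 - ∫ t', m t' ∂μ) * f t ^ 2) := key
    _ = (∫ t', imhAcceptQ w q t t' * q t' * f t' ^ 2 ∂μ)
          + (1 - ∫ t', imhAcceptQ w q t t' * q t' ∂μ) * f t ^ 2 := by
        rw [hm]; ring

variable [SFinite μ]

/-- **THE FLOW SAMPLER IS AN `L²(w)`-CONTRACTION AND `L²(w)` IS STABLE**: for measurable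
square-integrable `f`, `K f` is measurable, `(K f)² w ∈ L¹`, and `∫ (K f)² w ≤ ∫ f² w`
((stab) + (contr); pointwise Jensen, then exactness `∫ K(f²) w = ∫ f² w` on `L¹(w)`). -/
theorem imhOp_sq_integrable (hw0 : ∀ t, 0 < w t) (hwm : Measurable w)
    (hwi : Integrable w μ) (hq0 : ∀ t, 0 < q t) (hqm : Measurable q) (hqi : Integrable q μ)
    (hq1 : ∫ t, q t ∂μ = 1) {f : X → ℝ} (hfm : Measurable f)
    (hf2 : Integrable (fun t => f t ^ 2 * w t) μ) :
    Measurable (imhOp μ w q f) ∧ Integrable (fun t => imhOp μ w q f t ^ 2 * w t) μ ∧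
      ∫ t, imhOp μ w q f t ^ 2 * w t ∂μ ≤ ∫ t, f t ^ 2 * w t ∂μ := by
  have hKm : Measurable (imhOp μ w q f) := measurable_imhOp hwm hqm hfm
  obtain ⟨iK2, eK2⟩ :=
    integral_imhOp_mul_weight hw0 hwm hq0 hqm hqi hq1 (hfm.pow_const 2) hf2
  have hpt : ∀ t, imhOp μ w q f t ^ 2 * w t ≤ imhOp μ w q (fun s => f s ^ 2) t * w t := fun t =>
    mul_le_mul_of_nonneg_right (imhOp_sq_le_imhOp_sq_of_sq hw0 hwm hwi hq0 hqm hqi hq1 hfm hf2 t)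
      (hw0 t).le
  have iL : Integrable (fun t => imhOp μ w q f t ^ 2 * w t) μ := by
    refine Integrable.mono' iK2 ((hKm.pow_const 2).mul hwm).aestronglyMeasurable
      (Eventually.of_forall fun t => ?_)
    rw [Real.norm_eq_abs, abs_of_nonneg (mul_nonneg (sq_nonneg _) (hw0 t).le)]
    exact hpt t
  refine ⟨hKm, iL, ?_⟩
  calc ∫ t, imhOp μ w q f t ^ 2 * w t ∂μ
      ≤ ∫ t, imhOp μ w q (fun s => f s ^ 2) t * w t ∂μ := integral_mono iL iK2 hpt
    _ = ∫ t, f t ^ 2 * w t ∂μ := eK2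

/-! ## §2 Detailed balance on `L²(w)` -/

/-- **DETAILED BALANCE ON `L²(w)`**: `∫ (K f) h w dμ = ∫ f (K h) w dμ` for all measurable
square-integrable `f, h` — the exact flow sampler is self-adjoint on the whole of `L²(e^{−S})`, with
no hypothesis on the model density beyond positivity and `∫ q̃ = 1`. -/
theorem integral_imhOp_mul_mul_weight_comm (hw0 : ∀ t, 0 < w t) (hwm : Measurable w)
    (hwi : Integrable w μ) (hq0 : ∀ t, 0 < q t) (hqm : Measurable q) (hqi : Integrable q μ)
    (hq1 : ∫ t, q t ∂μ = 1) {f h : X → ℝ} (hfm : Measurable f) (hhm : Measurable h)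
    (hf2 : Integrable (fun t => f t ^ 2 * w t) μ) (hh2 : Integrable (fun t => h t ^ 2 * w t) μ) :
    ∫ t, imhOp μ w q f t * h t * w t ∂μ = ∫ t, f t * imhOp μ w q h t * w t ∂μ := by
  obtain ⟨hr0, hr1, hrm⟩ := rejection_bounds (μ := μ) hw0 hwm hq0 hqm hqi hq1
  have hw0' : ∀ t, 0 ≤ w t := fun t => (hw0 t).le
  have hfw := integrable_mul_weight_of_sq hw0' hwm hwi hfm hf2
  have hhw := integrable_mul_weight_of_sq hw0' hwm hwi hhm hh2
  have hfhw := integrable_mul_mul_weight_of_sq (μ := μ) hw0' hwm hfm hhm hf2 hh2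
  -- pointwise splits
  have hL : ∀ t, imhOp μ w q f t * h t * w t
      = (∫ t', imhFlow w q t t' * f t' * h t ∂μ)
        + f t * h t * w t * ∫ t', (1 - imhAcceptQ w q t t') * q t' ∂μ :=
    fun t => imhOp_mul_mul_weight_eq hw0 hwm hq0 hqm hqi hfm hfw t (h t)
  have hR : ∀ t, f t * imhOp μ w q h t * w t
      = (∫ t', imhFlow w q t t' * h t' * f t ∂μ)
        + f t * h t * w t * ∫ t', (1 - imhAcceptQ w q t t') * q t' ∂μ := by
    intro t
    have e := imhOp_mul_mul_weight_eq hw0 hwm hq0 hqm hqi hhm hhw t (f t)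
    calc f t * imhOp μ w q h t * w t = imhOp μ w q h t * f t * w t := by ring
      _ = (∫ t', imhFlow w q t t' * h t' * f t ∂μ)
          + h t * f t * w t * ∫ t', (1 - imhAcceptQ w q t t') * q t' ∂μ := e
      _ = _ := by ring
  have hIrej : Integrable (fun t => f t * h t * w t * ∫ t', (1 - imhAcceptQ w q t t') * q t' ∂μ) μ := by
    refine Integrable.mono' hfhw.abs (((hfm.mul hhm).mul hwm).mul hrm).aestronglyMeasurable
      (Eventually.of_forall fun t => ?_)
    rw [Real.norm_eq_abs, abs_mul, abs_of_nonneg (hr0 t)]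
    exact mul_le_of_le_one_right (abs_nonneg _) (hr1 t)
  have hPL := integrable_imhFlow_mul_mul_of_sq hw0 hwm hq0 hqm hqi hfm hhm hf2 hh2
  have hPR := integrable_imhFlow_mul_mul_of_sq hw0 hwm hq0 hqm hqi hhm hfm hh2 hf2
  have hswap : ∫ t, ∫ t', imhFlow w q t t' * f t' * h t ∂μ ∂μ
      = ∫ t, ∫ t', imhFlow w q t t' * h t' * f t ∂μ ∂μ := by
    rw [integral_integral_swap hPL]
    refine integral_congr_ae (Eventually.of_forall fun a => ?_)
    refine integral_congr_ae (Eventually.of_forall fun b => ?_)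
    show imhFlow w q b a * f a * h b = imhFlow w q a b * h b * f a
    rw [imhFlow_symm]; ring
  rw [integral_congr_ae (Eventually.of_forall hL), integral_congr_ae (Eventually.of_forall hR),
    integral_add hPL.integral_prod_left hIrej, integral_add hPR.integral_prod_left hIrej, hswap]

end General

end Summit.Ventures.LatticeQCDFlow.Exactness
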